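import Summits.NavierStokesRegularity.NavierStokesRegularity.Theorems.TerminalTraceTypeITraceScarL3LogMeanZoomSubseq
import HarnessLib

/-!
# T28-C storey (B2), zoom lemmas II: the a.e. `liminf` rate of the zoom limit for a TIME-DEPENDENT local rate
# (item `TerminalTrace.TypeITraceScarL3`, stmt-NavierStokesRegularity-18385, Stub LOUD line; helpers)

Seat nsreg-C26-p1 g2 (cell ns-regularity-ideate), `--supports stmt-NavierStokesRegularity-18385` (helper);
ROUND-28 §3 T28-C (nsreg-p2 g29), DIRECTOR-NS #130 (2).

* `norm_nsZoom_le_timeRate_of_ball` — under the zoom `v_c(s, y) = c v(c² s, c y)` a local time-dependent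
  rate `‖v(s, y)‖ ≤ b(s)` (`−δ₁ < s < 0`, `|y| < ρ₁`) becomes `‖v_c(s, y)‖ ≤ c·b(c² s)` (`−δ₁/c² < s < 0`,
  `|y| < ρ₁/c`).
* **`ae_liminfRate_of_zoomLimit_of_ball`** — the time-dependent twin of `ae_rate_of_zoomLimit_of_ball`: if the
  zooms `λ_j v(λ_j² ·, λ_j ·)`, `λ_j → 0⁺`, converge to `w` in `L³(Q(a))` for every `a`, then along ONE
  subsequence `φ` (`φ k ≥ k`, from `exists_subseq_ae_tendsto_of_L3loc`) the limit obeys, for a.e. `(s, y)` in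
  the lower slab, `‖w(s, y)‖ₑ ≤ liminf_k ofReal(λ_{φ k} · b(λ_{φ k}² s))` — the input of the Fatou step of the
  (LM_q) transfer.  Nothing is asked of `b`.

WHAT THIS IS NOT: not the (LM_q) transfer, not NS regularity. [folklore; AlbrittonBarker2019 §3]
-/

noncomputable section

set_option linter.dupNamespace false

namespace Summit.NavierStokesRegularity.NavierStokesRegularity.Theorems.TypeITraceScarL3

open MeasureTheory Set Function Filter Topology TopologicalSpace Metric
open Literature.Analysis Literature.Analysis.FluidPDE
open scoped NNReal ENNReal

/-- A local time-dependent rate under the Navier–Stokes zoom about the origin. [folklore] -/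
theorem norm_nsZoom_le_timeRate_of_ball {v : ℝ → EuclideanSpace ℝ (Fin 3) → EuclideanSpace ℝ (Fin 3)}
    {b : ℝ → ℝ} {δ₁ ρ₁ c : ℝ} (hc : 0 < c)
    (hrate : ∀ s ∈ Ioo (-δ₁) 0, ∀ y ∈ ball (0 : EuclideanSpace ℝ (Fin 3)) ρ₁, ‖v s y‖ ≤ b s)
    {s : ℝ} (hs : s ∈ Ioo (-(δ₁ / c ^ 2)) 0) {y : EuclideanSpace ℝ (Fin 3)}
    (hy : y ∈ ball (0 : EuclideanSpace ℝ (Fin 3)) (ρ₁ / c)) :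
    ‖(c • stPull (c ^ 2) c (0 : ℝ) (0 : EuclideanSpace ℝ (Fin 3)) v) s y‖ ≤ c * b (c ^ 2 * s) := by
  have hc2 : 0 < c ^ 2 := pow_pos hc 2
  have hs1 : -δ₁ < c ^ 2 * s := by
    have h := mul_lt_mul_of_pos_left hs.1 hc2
    rwa [mul_neg, mul_div_cancel₀ _ hc2.ne'] at h
  have hs2 : c ^ 2 * s < 0 := mul_neg_of_pos_of_neg hc2 hs.2
  have hcy : c • y ∈ ball (0 : EuclideanSpace ℝ (Fin 3)) ρ₁ := by
    rw [mem_ball_zero_iff] at hy ⊢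
    rw [norm_smul, Real.norm_of_nonneg hc.le]
    calc c * ‖y‖ < c * (ρ₁ / c) := mul_lt_mul_of_pos_left hy hc
      _ = ρ₁ := mul_div_cancel₀ ρ₁ hc.ne'
  have hb := hrate (c ^ 2 * s) ⟨hs1, hs2⟩ (c • y) hcy
  rw [smul_stPull_apply, zero_add, zero_add, norm_smul, Real.norm_of_nonneg hc.le]
  exact mul_le_mul_of_nonneg_left hb hc.le

/-- **The a.e. `liminf` rate of the zoom limit along one subsequence** (module docstring). [folklore;
AlbrittonBarker2019 §3] -/
theorem ae_liminfRate_of_zoomLimit_of_ball {v w : ℝ → EuclideanSpace ℝ (Fin 3) → EuclideanSpace ℝ (Fin 3)}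
    {b : ℝ → ℝ} {δ₁ ρ₁ : ℝ} (hδ₁ : 0 < δ₁) (hρ₁ : 0 < ρ₁)
    (hrate : ∀ s ∈ Ioo (-δ₁) 0, ∀ y ∈ ball (0 : EuclideanSpace ℝ (Fin 3)) ρ₁, ‖v s y‖ ≤ b s)
    {lam : ℕ → ℝ} (hlam : ∀ j, 0 < lam j) (hlam0 : Tendsto lam atTop (𝓝 0))
    (hvm : ∀ a : ℝ, 0 < a → ∀ᶠ j in atTop, AEStronglyMeasurable
      (uncurry ((lam j) • stPull ((lam j) ^ 2) (lam j) (0 : ℝ) (0 : EuclideanSpace ℝ (Fin 3)) v))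
      (volume.restrict (parabolicCylinder a (0 : ℝ × EuclideanSpace ℝ (Fin 3)))))
    (hlim : ∀ a : ℝ, 0 < a →
      AEStronglyMeasurable (uncurry w)
        (volume.restrict (parabolicCylinder a (0 : ℝ × EuclideanSpace ℝ (Fin 3)))) ∧
      Tendsto (fun j => eLpNorm
          (uncurry ((lam j) • stPull ((lam j) ^ 2) (lam j) (0 : ℝ)
            (0 : EuclideanSpace ℝ (Fin 3)) v) - uncurry w) 3
          (volume.restrict (parabolicCylinder a (0 : ℝ × EuclideanSpace ℝ (Fin 3)))))
        atTop (𝓝 0)) :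
    ∃ φ : ℕ → ℕ, (∀ k, k ≤ φ k) ∧
      ∀ᵐ z ∂(volume.restrict (Iio (0 : ℝ) ×ˢ (univ : Set (EuclideanSpace ℝ (Fin 3))))),
        ‖w z.1 z.2‖ₑ ≤ liminf (fun k => ENNReal.ofReal (lam (φ k) * b ((lam (φ k)) ^ 2 * z.1))) atTop := by
  obtain ⟨φ, hφ, hae⟩ := exists_subseq_ae_tendsto_of_L3loc
    (F := fun j => uncurry ((lam j) • stPull ((lam j) ^ 2) (lam j) (0 : ℝ) (0 : EuclideanSpace ℝ (Fin 3)) v))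
    (w := uncurry w) hvm (fun a ha => (hlim a ha).1) (fun a ha => (hlim a ha).2)
  refine ⟨φ, hφ, ?_⟩
  -- the scales along `φ` still tend to `0`
  have hφtop : Tendsto φ atTop atTop := tendsto_atTop_mono hφ tendsto_id
  have hlamφ : Tendsto (fun k => lam (φ k)) atTop (𝓝 0) := hlam0.comp hφtop
  filter_upwards [hae, ae_restrict_mem (measurableSet_Iio.prod MeasurableSet.univ)] with z hz hzS
  obtain ⟨s, y⟩ := z
  have hs : s < 0 := hzS.1
  -- eventually the zoom bound holds at `(s, y)`
  have hev1 : ∀ᶠ k in atTop, lam (φ k) < Real.sqrt (δ₁ / (-s)) :=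
    hlamφ (Iio_mem_nhds (Real.sqrt_pos.2 (div_pos hδ₁ (by linarith))))
  have hev2 : ∀ᶠ k in atTop, lam (φ k) < ρ₁ / (‖y‖ + 1) :=
    hlamφ (Iio_mem_nhds (div_pos hρ₁ (by positivity)))
  have hbd : ∀ᶠ k in atTop,
      (‖(uncurry ((lam (φ k)) • stPull ((lam (φ k)) ^ 2) (lam (φ k)) (0 : ℝ)
        (0 : EuclideanSpace ℝ (Fin 3)) v)) (s, y)‖ₑ : ℝ≥0∞) ≤
        ENNReal.ofReal (lam (φ k) * b ((lam (φ k)) ^ 2 * s)) := by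
    filter_upwards [hev1, hev2] with k hk1 hk2
    have hμ : 0 < lam (φ k) := hlam _
    have hs' : s ∈ Ioo (-(δ₁ / (lam (φ k)) ^ 2)) 0 := by
      refine ⟨?_, hs⟩
      rw [neg_lt, lt_div_iff₀ (pow_pos hμ 2)]
      have h1 : (lam (φ k)) ^ 2 < δ₁ / (-s) := by
        have h2 : (lam (φ k)) ^ 2 < (Real.sqrt (δ₁ / (-s))) ^ 2 :=
          pow_lt_pow_left₀ hk1 hμ.le two_ne_zero
        rwa [Real.sq_sqrt (div_pos hδ₁ (by linarith)).le] at h2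
      rw [lt_div_iff₀ (by linarith : (0 : ℝ) < -s)] at h1
      linarith
    have hy' : y ∈ ball (0 : EuclideanSpace ℝ (Fin 3)) (ρ₁ / lam (φ k)) := by
      rw [mem_ball_zero_iff, lt_div_iff₀ hμ]
      rw [lt_div_iff₀ (by positivity : (0 : ℝ) < ‖y‖ + 1)] at hk2
      nlinarith [norm_nonneg y, hμ]
    have h := norm_nsZoom_le_timeRate_of_ball hμ hrate hs' hy'
    rw [uncurry_apply_pair, ← ofReal_norm]
    exact ENNReal.ofReal_le_ofReal h
  -- pass to the limit
  have hlim' : Tendsto (fun k => (‖(uncurry ((lam (φ k)) • stPull ((lam (φ k)) ^ 2) (lam (φ k)) (0 : ℝ)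
      (0 : EuclideanSpace ℝ (Fin 3)) v)) (s, y)‖ₑ : ℝ≥0∞)) atTop (𝓝 ‖w s y‖ₑ) := by
    have h := hz.norm
    simp only [uncurry_apply_pair] at h ⊢
    have h2 := (ENNReal.continuous_ofReal.tendsto _).comp h
    simpa only [Function.comp_def, ofReal_norm] using h2
  rw [← hlim'.liminf_eq]
  exact liminf_le_liminf hbd
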